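import Summits.QuantumFields.YangMills.Theorems.AlphaInputsT3ACv3LinearLiftFluxPrefix
import HarnessLib

/-!
# `AlphaInputsT3ACv3LinearLiftFluxClass` — «ZCLASS»: THE INTEGER CLASS DECOMPOSITION OF AN INTEGER 2-COCYCLE ON THE DISCRETE 3-TORUS — `m = Σ_{μ<ν} q_{μν}·E_{μν} + curl s` with an
# INTEGER one-cochain `s` (five sweeps of the prefix-sum tool ✓`…LinearLiftFluxPrefix`) — cell `ym3-torus`, width seat `ym-ust-20520-w5` (g8), line «SYM-CENTRE» (EX cure (ii-a))

WHY.  The (R4) assembly (px20 g2) reads the angles `θ` of the diagonalised coarse field; `curl θ = φ + 2π·m` with `m` an INTEGER 2-cocycle (✓`int_cube_of_near_curl`), whose Dirac strings sit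
wherever the principal angles wrap — an arbitrary integer cocycle, not the STANDARD one `Σ q_{μν}E_{μν}` that ✓`exists_fluxLift` lifts.  THIS FILE moves the strings to the standard
position by an INTEGER gauge: `m = q·E + curl s`, `s : bonds → ℤ`, so that `θ − 2π·s` defines the SAME `U(1)`∕diagonal field and has standard integer part.  Written in COMPONENTS for
three pairwise distinct directions `e₀ e₁ e₂` of a general torus `Site P j` (for the T³ member: `0 1 2`, which exhaust `Fin 3`): a 2-cochain is the triple `(m₀₁, m₀₂, m₁₂)`, a 1-cochain
the triple `(s₀, s₁, s₂)`, `curl₀₁ s = s₀ + s₁(·+e₀) − s₀(·+e₁) − s₁`, and the cocycle (cube) identity reads `[m₀₁ − m₀₁(·+e₂)] − [m₀₂ − m₀₂(·+e₁)] + [m₁₂ − m₁₂(·+e₀)] = 0`.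
THE FIVE SWEEPS (§3): (1) integrate `m₀₁, m₀₂` along `e₀` (`s₁ := pre₀ m₀₁`, `s₂ := pre₀ m₀₂`): residues `[x₀=−1]·T₀ⱼ` (`T₀ⱼ = tot₀ m₀ⱼ`) and, by the cube identity + telescoping,
`m₁₂ ↦ m₁₂|_{x₀ = 0}`; (2) integrate that along `e₁`: residue `[x₁=−1]·R`; (3) seam sweep of `R` along `e₂` (zero-period integrand `R − [x₂=−1]·tot₂R`): residue `[x₁=−1][x₂=−1]·Q`, `Q`
constant `=: q₁₂`; (4) the seam pair `(T₀₁, T₀₂)` is CLOSED on the `(e₁,e₂)`-torus (cube identity at `x₀ = −1`): integrate `T₀₁` along `e₁` through the `e₀`-component `s₀ := −[x₀=−1]·pre₁T₀₁`: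
residues `[x₀=−1][x₁=−1]·W` (`W` constant `=: q₀₁` by the cube identity once more) and `[x₀=−1]·T₀₂|_{x₁=0}`; (5) seam sweep of the latter along `e₂`: `[x₀=−1][x₂=−1]·q₀₂`.  §4 packages
★★★`exists_int_class_decomposition₃`.
HONEST FRAMING.  Elementary integer bookkeeping on the discrete torus (the `H²(T³;ℤ) ≅ ℤ³` computation with explicit representatives); nothing of [Balaban] asserted; count-neutral helper
toward EX (`--supports stmt-QuantumFields-19200 --as helper`); def-free; every landed file untouched.  YM₃ on the torus is a RUNG (R3), not the Clay problem; no claim about d = 4,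
infinite volume or a mass gap; nothing of the stub ∕ crux is claimed.

References: T. Bałaban, Commun. Math. Phys. 109 (1987) 249–301 [Balaban1987RG1] ((0.1) p.251: the tori); Commun. Math. Phys. 98 (1985) 17–51 [Balaban1985Averaging] ((9) p.19: lattice curl).
-/

set_option autoImplicit false

noncomputable section

namespace Summit.QuantumFields.YangMills.Theorems.LinearLiftFlux

open scoped BigOperators
open Finset
open Literature.MathematicalPhysics.QuantumFieldTheory.Balaban1983to89
open Literature.MathematicalPhysics.QuantumFieldTheory.Balaban1983to89.BlockAveragingEMLProp2 (shift_shift_comm)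

variable {P : Params} {j : ℕ}

/-! ## §1 Indicators of the last residue, periods of seam functions, constancy -/

/-- The last-residue indicator of direction `κ` is blind to a shift in another direction. [folklore] -/
theorem ite_shift_ne (x : Site P j) {κ lam : Fin P.d} (h : lam ≠ κ) (a b : ℤ) :
    (if (x.shift lam) κ = -1 then a else b) = if x κ = -1 then a else b := by
  rw [Site.shift_apply, if_neg (Ne.symm h)]

/-- **THE PERIOD OF A SEAM FUNCTION**: `tot κ ([·_κ = −1]·Q) = Q` when `Q` does not depend on `x_κ` (exactly one label, `M − 1`, reads `−1`). [folklore] -/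
theorem tot_ite_mul (κ : Fin P.d) (Q : Site P j → ℤ) (hQ : ∀ y t, Q (colAt y κ t) = Q y) (x : Site P j) :
    tot κ (fun y => (if y κ = -1 then 1 else 0) * Q y) x = Q x := by
  have hM := P.one_lt_sitesPerDir j
  unfold tot
  simp_rw [colAt_apply_self, hQ]
  rw [Finset.sum_eq_single (P.sitesPerDir j - 1)]
  · rw [if_pos ((natCast_eq_neg_one_iff (P := P) (j := j) (by omega)).mpr (by omega)), one_mul]
  · intro t ht hne
    rw [mem_range] at ht
    rw [if_neg (fun h => hne (by have := (natCast_eq_neg_one_iff (P := P) (j := j) (by omega)).mp h; omega)), zero_mul]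
  · intro h; exact absurd (mem_range.mpr (by omega)) h

/-- **A FUNCTION INDEPENDENT OF THREE EXHAUSTING COORDINATES IS CONSTANT.** [folklore] -/
theorem eq_of_indep₃ {e₀ e₁ e₂ : Fin P.d} (hall : ∀ κ : Fin P.d, κ = e₀ ∨ κ = e₁ ∨ κ = e₂) (Q : Site P j → ℤ)
    (h0 : ∀ y t, Q (colAt y e₀ t) = Q y) (h1 : ∀ y t, Q (colAt y e₁ t) = Q y) (h2 : ∀ y t, Q (colAt y e₂ t) = Q y) (x y : Site P j) : Q x = Q y := by
  have e : y = colAt (colAt (colAt x e₀ (y e₀).val) e₁ (y e₁).val) e₂ (y e₂).val := by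
    funext κ
    rcases hall κ with h | h | h <;> subst h
    · by_cases h20 : κ = e₂
      · rw [h20, colAt_apply_self, ZMod.natCast_zmod_val]
      · rw [colAt_apply_ne _ h20]
        by_cases h10 : κ = e₁
        · rw [h10, colAt_apply_self, ZMod.natCast_zmod_val]
        · rw [colAt_apply_ne _ h10, colAt_apply_self, ZMod.natCast_zmod_val]
    · by_cases h21 : κ = e₂
      · rw [h21, colAt_apply_self, ZMod.natCast_zmod_val]
      · rw [colAt_apply_ne _ h21, colAt_apply_self, ZMod.natCast_zmod_val]
    · rw [colAt_apply_self, ZMod.natCast_zmod_val]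
  rw [e, h2, h1, h0]

/-- **THE INTEGER BIANCHI IDENTITY IN COMPONENTS**: the curl of ANY integer one-cochain `(s₀, s₁, s₂)` satisfies the cube identity. [cite: Balaban1985Averaging, (9) p.19] -/
theorem cube_of_curl (e₀ e₁ e₂ : Fin P.d) (s₀ s₁ s₂ : Site P j → ℤ) (x : Site P j) :
    ((s₀ x + s₁ (x.shift e₀) - s₀ (x.shift e₁) - s₁ x) - (s₀ (x.shift e₂) + s₁ ((x.shift e₂).shift e₀) - s₀ ((x.shift e₂).shift e₁) - s₁ (x.shift e₂)))
      - ((s₀ x + s₂ (x.shift e₀) - s₀ (x.shift e₂) - s₂ x) - (s₀ (x.shift e₁) + s₂ ((x.shift e₁).shift e₀) - s₀ ((x.shift e₁).shift e₂) - s₂ (x.shift e₁)))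
      + ((s₁ x + s₂ (x.shift e₁) - s₁ (x.shift e₂) - s₂ x) - (s₁ (x.shift e₀) + s₂ ((x.shift e₀).shift e₁) - s₁ ((x.shift e₀).shift e₂) - s₂ (x.shift e₀))) = 0 := by
  rw [shift_shift_comm x e₂ e₀, shift_shift_comm x e₂ e₁, shift_shift_comm x e₁ e₀]
  ring

/-! ## §2 The elementary sweeps -/

/-- The indicator of a conjunction of two last-residue conditions is the product of the indicators. [folklore] -/
theorem ite_and_eq_mul (x : Site P j) (κ lam : Fin P.d) :
    (if x κ = -1 ∧ x lam = -1 then (1 : ℤ) else 0) = (if x κ = -1 then (1 : ℤ) else 0) * (if x lam = -1 then 1 else 0) := by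
  by_cases h1 : x κ = -1 <;> by_cases h2 : x lam = -1 <;> simp [h1, h2]

/-- **PLAIN SWEEP** along `κ`: `f = (pre_κ f(·+e_κ) − pre_κ f) + [x_κ = −1]·tot_κ f`. [folklore] -/
theorem sweep_plain (κ : Fin P.d) (f : Site P j → ℤ) (x : Site P j) :
    f x = (pre κ f (x.shift κ) - pre κ f x) + (if x κ = -1 then 1 else 0) * tot κ f x := by
  rw [pre_shift_self]; split_ifs <;> ring

/-- **SEAM SWEEP** along `κ`: with the zero-period integrand `g := f − [x_κ = −1]·tot_κ f`, `f = (pre_κ g(·+e_κ) − pre_κ g) + [x_κ = −1]·tot_κ f` and NO new seam term. [folklore] -/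
theorem sweep_seam (κ : Fin P.d) (f : Site P j → ℤ) (x : Site P j) :
    f x = (pre κ (fun y => f y - (if y κ = -1 then 1 else 0) * tot κ f y) (x.shift κ) - pre κ (fun y => f y - (if y κ = -1 then 1 else 0) * tot κ f y) x)
      + (if x κ = -1 then 1 else 0) * tot κ f x := by
  have hper : tot κ (fun y => f y - (if y κ = -1 then 1 else 0) * tot κ f y) x = 0 := by
    rw [tot_sub, tot_ite_mul κ (tot κ f) (fun y t => tot_colAt κ f y t) x]; ring
  rw [pre_shift_self, hper]; split_ifs <;> ring

/-- **SWEEP 1, THE `(1,2)` COMPONENT** (the cube identity turns the `(1,2)`-curl of the `e₀`-primitives into a telescoping sum): with `s₁ := pre₀ m₀₁`, `s₂ := pre₀ m₀₂`,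
`m₁₂ = curl₁₂(s) + m₁₂|_{x₀=0}`. [folklore] -/
theorem sweep₁ {e₀ e₁ e₂ : Fin P.d} (h01 : e₀ ≠ e₁) (h02 : e₀ ≠ e₂) (m₀₁ m₀₂ m₁₂ : Site P j → ℤ)
    (hcube : ∀ x, (m₀₁ x - m₀₁ (x.shift e₂)) - (m₀₂ x - m₀₂ (x.shift e₁)) + (m₁₂ x - m₁₂ (x.shift e₀)) = 0) (x : Site P j) :
    m₁₂ x = (pre e₀ m₀₁ x + pre e₀ m₀₂ (x.shift e₁) - pre e₀ m₀₁ (x.shift e₂) - pre e₀ m₀₂ x) + m₁₂ (colAt x e₀ 0) := by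
  rw [pre_shift_ne e₀ m₀₂ x (Ne.symm h01), pre_shift_ne e₀ m₀₁ x (Ne.symm h02)]
  have key : pre e₀ m₀₁ x + pre e₀ (fun y => m₀₂ (y.shift e₁)) x - pre e₀ (fun y => m₀₁ (y.shift e₂)) x - pre e₀ m₀₂ x =
      pre e₀ (fun y => m₁₂ (y.shift e₀) - m₁₂ y) x := by
    rw [← pre_add, ← pre_sub, ← pre_sub]
    exact pre_congr e₀ (fun y => by have := hcube y; linarith) x
  rw [key, pre_sub_shift]; ring

/-! ## §3 The decomposition in components -/

/-- **★★★ «ZCLASS» IN COMPONENTS**: every integer 2-cocycle `(m₀₁, m₀₂, m₁₂)` on the discrete 3-torus (three pairwise distinct directions exhausting `Fin d`) is `q·E + curl s`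
with integers `q₀₁ q₀₂ q₁₂`, the standard cocycles `E_{μν}(x) = [x_μ = −1 ∧ x_ν = −1]`, and an INTEGER one-cochain `(s₀, s₁, s₂)`. [folklore] -/
theorem exists_int_class_decomposition_comp {e₀ e₁ e₂ : Fin P.d} (h01 : e₀ ≠ e₁) (h02 : e₀ ≠ e₂) (h12 : e₁ ≠ e₂)
    (hall : ∀ κ : Fin P.d, κ = e₀ ∨ κ = e₁ ∨ κ = e₂) (m₀₁ m₀₂ m₁₂ : Site P j → ℤ)
    (hcube : ∀ x, (m₀₁ x - m₀₁ (x.shift e₂)) - (m₀₂ x - m₀₂ (x.shift e₁)) + (m₁₂ x - m₁₂ (x.shift e₀)) = 0) :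
    ∃ (q₀₁ q₀₂ q₁₂ : ℤ) (s₀ s₁ s₂ : Site P j → ℤ), ∀ x,
      (m₀₁ x = q₀₁ * (if x e₀ = -1 ∧ x e₁ = -1 then 1 else 0) + (s₀ x + s₁ (x.shift e₀) - s₀ (x.shift e₁) - s₁ x)) ∧
      (m₀₂ x = q₀₂ * (if x e₀ = -1 ∧ x e₂ = -1 then 1 else 0) + (s₀ x + s₂ (x.shift e₀) - s₀ (x.shift e₂) - s₂ x)) ∧
      (m₁₂ x = q₁₂ * (if x e₁ = -1 ∧ x e₂ = -1 then 1 else 0) + (s₁ x + s₂ (x.shift e₁) - s₁ (x.shift e₂) - s₂ x)) := by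
  have h10 := Ne.symm h01; have h20 := Ne.symm h02; have h21 := Ne.symm h12
  have hM := P.one_lt_sitesPerDir j
  -- SWEEP 1 data: the seam pair `(T₁, T₂)` and the `e₀`-flattened `(1,2)` component `n₁₂`
  obtain ⟨T₁, hT₁⟩ : ∃ f : Site P j → ℤ, f = tot e₀ m₀₁ := ⟨_, rfl⟩
  obtain ⟨T₂, hT₂⟩ : ∃ f : Site P j → ℤ, f = tot e₀ m₀₂ := ⟨_, rfl⟩
  obtain ⟨n₁₂, hn₁₂⟩ : ∃ f : Site P j → ℤ, f = fun x => m₁₂ (colAt x e₀ 0) := ⟨_, rfl⟩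
  have A1 : ∀ x, m₀₁ x = (pre e₀ m₀₁ (x.shift e₀) - pre e₀ m₀₁ x) + (if x e₀ = -1 then 1 else 0) * T₁ x := fun x => by
    rw [hT₁]; exact sweep_plain e₀ m₀₁ x
  have A2 : ∀ x, m₀₂ x = (pre e₀ m₀₂ (x.shift e₀) - pre e₀ m₀₂ x) + (if x e₀ = -1 then 1 else 0) * T₂ x := fun x => by
    rw [hT₂]; exact sweep_plain e₀ m₀₂ x
  have A3 : ∀ x, m₁₂ x = (pre e₀ m₀₁ x + pre e₀ m₀₂ (x.shift e₁) - pre e₀ m₀₁ (x.shift e₂) - pre e₀ m₀₂ x) + n₁₂ x := fun x => by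
    rw [hn₁₂]; exact sweep₁ h01 h02 m₀₁ m₀₂ m₁₂ hcube x
  have hT₁i : ∀ y t, T₁ (colAt y e₀ t) = T₁ y := fun y t => by rw [hT₁]; exact tot_colAt e₀ m₀₁ y t
  have hT₂i : ∀ y t, T₂ (colAt y e₀ t) = T₂ y := fun y t => by rw [hT₂]; exact tot_colAt e₀ m₀₂ y t
  have hn₁₂i : ∀ y t, n₁₂ (colAt y e₀ t) = n₁₂ y := fun y t => by rw [hn₁₂]; simp only [colAt_colAt_self]
  -- the residual of sweep 1 is a cocycle; at the seam `x₀ = −1` this says the pair `(T₁, T₂)` is CLOSED on the `(e₁,e₂)`-torus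
  have hclosed : ∀ x, T₁ x - T₁ (x.shift e₂) - (T₂ x - T₂ (x.shift e₁)) = 0 := by
    intro x
    have hres : ∀ y, ((if y e₀ = -1 then (1:ℤ) else 0) * T₁ y - (if (y.shift e₂) e₀ = -1 then (1:ℤ) else 0) * T₁ (y.shift e₂))
        - ((if y e₀ = -1 then (1:ℤ) else 0) * T₂ y - (if (y.shift e₁) e₀ = -1 then (1:ℤ) else 0) * T₂ (y.shift e₁))
        + (n₁₂ y - n₁₂ (y.shift e₀)) = 0 := by
      intro y
      have a1 := A1 y; have b1 := A1 (y.shift e₂); have a2 := A2 y; have c2 := A2 (y.shift e₁); have a3 := A3 y; have d3 := A3 (y.shift e₀)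
      have hB := cube_of_curl e₀ e₁ e₂ (fun _ => (0:ℤ)) (pre e₀ m₀₁) (pre e₀ m₀₂) y
      try dsimp only at hB
      linear_combination hcube y - hB - a1 + b1 + a2 - c2 - a3 + d3
    have h := hres (colAt x e₀ (P.sitesPerDir j - 1))
    have hx'0 : colAt x e₀ (P.sitesPerDir j - 1) e₀ = -1 := by rw [colAt_apply_self, natCast_eq_neg_one_iff (by omega)]; omega
    rw [ite_shift_ne _ h20, ite_shift_ne _ h10, if_pos hx'0, one_mul, one_mul, one_mul, one_mul,
      shift_invariant_of_indep e₀ n₁₂ hn₁₂i, sub_self, add_zero, colAt_shift_ne x h20, colAt_shift_ne x h10, hT₁i, hT₁i, hT₂i, hT₂i] at h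
    exact h
  -- SWEEP 2∕3 data: `R := tot₁ n₁₂`, `Q := tot₂ R` (constant), zero-period integrand `g₃`
  obtain ⟨R, hR⟩ : ∃ f : Site P j → ℤ, f = tot e₁ n₁₂ := ⟨_, rfl⟩
  obtain ⟨Q, hQ⟩ : ∃ f : Site P j → ℤ, f = tot e₂ R := ⟨_, rfl⟩
  obtain ⟨g₃, hg₃⟩ : ∃ f : Site P j → ℤ, f = fun y => R y - (if y e₂ = -1 then 1 else 0) * tot e₂ R y := ⟨_, rfl⟩
  have B2 : ∀ x, n₁₂ x = (pre e₁ n₁₂ (x.shift e₁) - pre e₁ n₁₂ x) + (if x e₁ = -1 then 1 else 0) * R x := fun x => by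
    rw [hR]; exact sweep_plain e₁ n₁₂ x
  have C3 : ∀ x, R x = (pre e₂ g₃ (x.shift e₂) - pre e₂ g₃ x) + (if x e₂ = -1 then 1 else 0) * Q x := fun x => by
    rw [hg₃, hQ]; exact sweep_seam e₂ R x
  have hRi1 : ∀ y t, R (colAt y e₁ t) = R y := fun y t => by rw [hR]; exact tot_colAt e₁ n₁₂ y t
  have hRi0 : ∀ y t, R (colAt y e₀ t) = R y := fun y t => by rw [hR]; exact tot_indep e₁ n₁₂ h01 hn₁₂i y t
  have hQi2 : ∀ y t, Q (colAt y e₂ t) = Q y := fun y t => by rw [hQ]; exact tot_colAt e₂ R y t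
  have hQi1 : ∀ y t, Q (colAt y e₁ t) = Q y := fun y t => by rw [hQ]; exact tot_indep e₂ R h12 hRi1 y t
  have hQi0 : ∀ y t, Q (colAt y e₀ t) = Q y := fun y t => by rw [hQ]; exact tot_indep e₂ R h02 hRi0 y t
  have hg₃i0 : ∀ y t, g₃ (colAt y e₀ t) = g₃ y := fun y t => by
    rw [hg₃]; dsimp only; rw [hRi0, colAt_apply_ne y h20, ← hQ, hQi0]
  have hg₃i1 : ∀ y t, g₃ (colAt y e₁ t) = g₃ y := fun y t => by
    rw [hg₃]; dsimp only; rw [hRi1, colAt_apply_ne y h21, ← hQ, hQi1]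
  -- SWEEP 4∕5 data: `W := tot₁ T₁` (constant), `Tb := T₂|_{x₁=0}`, `Q' := tot₂ Tb` (constant), zero-period integrand `g₅`
  obtain ⟨W, hW⟩ : ∃ f : Site P j → ℤ, f = tot e₁ T₁ := ⟨_, rfl⟩
  obtain ⟨Tb, hTb⟩ : ∃ f : Site P j → ℤ, f = fun y => T₂ (colAt y e₁ 0) := ⟨_, rfl⟩
  obtain ⟨Q', hQ'⟩ : ∃ f : Site P j → ℤ, f = tot e₂ Tb := ⟨_, rfl⟩
  obtain ⟨g₅, hg₅⟩ : ∃ f : Site P j → ℤ, f = fun y => Tb y - (if y e₂ = -1 then 1 else 0) * tot e₂ Tb y := ⟨_, rfl⟩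
  have D4 : ∀ x, T₁ x = (pre e₁ T₁ (x.shift e₁) - pre e₁ T₁ x) + (if x e₁ = -1 then 1 else 0) * W x := fun x => by
    rw [hW]; exact sweep_plain e₁ T₁ x
  have D4' : ∀ x, pre e₁ T₁ (x.shift e₂) - pre e₁ T₁ x = T₂ x - Tb x := fun x => by
    rw [pre_shift_ne e₁ T₁ x h21, ← pre_sub]
    have e : ∀ y, T₁ (y.shift e₂) - T₁ y = T₂ (y.shift e₁) - T₂ y := fun y => by have := hclosed y; linarith
    rw [pre_congr e₁ e x, pre_sub_shift, hTb]
  have E5 : ∀ x, Tb x = (pre e₂ g₅ (x.shift e₂) - pre e₂ g₅ x) + (if x e₂ = -1 then 1 else 0) * Q' x := fun x => by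
    rw [hg₅, hQ']; exact sweep_seam e₂ Tb x
  have hWi1 : ∀ y t, W (colAt y e₁ t) = W y := fun y t => by rw [hW]; exact tot_colAt e₁ T₁ y t
  have hWi0 : ∀ y t, W (colAt y e₀ t) = W y := fun y t => by rw [hW]; exact tot_indep e₁ T₁ h01 hT₁i y t
  have hWshift2 : ∀ y, W (y.shift e₂) = W y := by
    intro y
    rw [hW, tot_shift_ne e₁ T₁ y h21]
    have e : ∀ z, T₁ (z.shift e₂) = T₁ z + (T₂ (z.shift e₁) - T₂ z) := fun z => by have := hclosed z; linarith
    rw [tot_congr e₁ e y, tot_add, tot_sub_shift, add_zero]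
  have hWi2 : ∀ y t, W (colAt y e₂ t) = W y := colAt_eq_of_shift_invariant e₂ W hWshift2
  have hTbi1 : ∀ y t, Tb (colAt y e₁ t) = Tb y := fun y t => by rw [hTb]; simp only [colAt_colAt_self]
  have hTbi0 : ∀ y t, Tb (colAt y e₀ t) = Tb y := fun y t => by rw [hTb]; dsimp only; rw [colAt_colAt_comm y h01, hT₂i]
  have hQ'i2 : ∀ y t, Q' (colAt y e₂ t) = Q' y := fun y t => by rw [hQ']; exact tot_colAt e₂ Tb y t
  have hQ'i1 : ∀ y t, Q' (colAt y e₁ t) = Q' y := fun y t => by rw [hQ']; exact tot_indep e₂ Tb h12 hTbi1 y t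
  have hQ'i0 : ∀ y t, Q' (colAt y e₀ t) = Q' y := fun y t => by rw [hQ']; exact tot_indep e₂ Tb h02 hTbi0 y t
  have hg₅i1 : ∀ y t, g₅ (colAt y e₁ t) = g₅ y := fun y t => by
    rw [hg₅]; dsimp only; rw [hTbi1, colAt_apply_ne y h21, ← hQ', hQ'i1]
  have hg₅i0 : ∀ y t, g₅ (colAt y e₀ t) = g₅ y := fun y t => by
    rw [hg₅]; dsimp only; rw [hTbi0, colAt_apply_ne y h20, ← hQ', hQ'i0]
  -- the constants
  let x₀ : Site P j := fun _ => 0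
  refine ⟨W x₀, Q' x₀, Q x₀,
    fun x => -((if x e₀ = -1 then 1 else 0) * pre e₁ T₁ x) - (if x e₀ = -1 then 1 else 0) * pre e₂ g₅ x,
    fun x => pre e₀ m₀₁ x - (if x e₁ = -1 then 1 else 0) * pre e₂ g₃ x,
    fun x => pre e₀ m₀₂ x + pre e₁ n₁₂ x, fun x => ⟨?_, ?_, ?_⟩⟩
  · -- the `(0,1)` component
    have a1 := A1 x
    have u2 : pre e₁ T₁ (x.shift e₁) - pre e₁ T₁ x = T₁ x - (if x e₁ = -1 then 1 else 0) * W x := by have := D4 x; linarith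
    have hWc : W x = W x₀ := eq_of_indep₃ hall W hWi0 hWi1 hWi2 x x₀
    have u1 : pre e₂ g₃ (x.shift e₀) = pre e₂ g₃ x := by rw [shift_eq_colAt, pre_indep e₂ g₃ h02 hg₃i0]
    have u3 : pre e₂ g₅ (x.shift e₁) = pre e₂ g₅ x := by rw [shift_eq_colAt, pre_indep e₂ g₅ h12 hg₅i1]
    dsimp only
    rw [ite_shift_ne x h10, ite_shift_ne x h01, ite_and_eq_mul, u1, u3]
    linear_combination a1 - (if x e₀ = -1 then (1:ℤ) else 0) * u2 + ((if x e₀ = -1 then (1:ℤ) else 0) * (if x e₁ = -1 then (1:ℤ) else 0)) * hWc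
  · -- the `(0,2)` component
    have a2 := A2 x
    have d' := D4' x
    have e5 : pre e₂ g₅ (x.shift e₂) - pre e₂ g₅ x = Tb x - (if x e₂ = -1 then 1 else 0) * Q' x := by have := E5 x; linarith
    have hQ'c : Q' x = Q' x₀ := eq_of_indep₃ hall Q' hQ'i0 hQ'i1 hQ'i2 x x₀
    have un : pre e₁ n₁₂ (x.shift e₀) = pre e₁ n₁₂ x := by rw [shift_eq_colAt, pre_indep e₁ n₁₂ h01 hn₁₂i]
    dsimp only
    rw [ite_shift_ne x h20, ite_and_eq_mul, un]
    linear_combination a2 - (if x e₀ = -1 then (1:ℤ) else 0) * d' - (if x e₀ = -1 then (1:ℤ) else 0) * e5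
      + ((if x e₀ = -1 then (1:ℤ) else 0) * (if x e₂ = -1 then (1:ℤ) else 0)) * hQ'c
  · -- the `(1,2)` component
    have a3 := A3 x
    have b2 := B2 x
    have c3 := C3 x
    have hQc : Q x = Q x₀ := eq_of_indep₃ hall Q hQi0 hQi1 hQi2 x x₀
    dsimp only
    rw [ite_shift_ne x h21, ite_and_eq_mul]
    linear_combination a3 + b2 + (if x e₁ = -1 then (1:ℤ) else 0) * c3 + ((if x e₁ = -1 then (1:ℤ) else 0) * (if x e₂ = -1 then (1:ℤ) else 0)) * hQc

/-! ## §4 The decomposition for an antisymmetric integer 2-cocycle -/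

/-- **★★★ «ZCLASS»**: on a discrete torus whose directions are exhausted by three pairwise distinct `e₀ e₁ e₂` (the T³ member: `0 1 2`), every antisymmetric INTEGER 2-cocycle
`m` (cube identity as in ✓`int_cube_of_near_curl`) is `m(x;μν) = q_{μν}·[x_μ = −1 ∧ x_ν = −1] + curl s (x;μν)` with `q` antisymmetric integers and `s : bonds → ℤ` — the class
`[m] ∈ H²(T³;ℤ) ≅ ℤ³` with its standard representative, plus an INTEGER coboundary (so `θ − 2π·s` has the same `U(1)` field as `θ` and a standard integer part, ready for
✓`exists_fluxLift`). [folklore] -/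
theorem exists_int_class_decomposition₃ {e₀ e₁ e₂ : Fin P.d} (h01 : e₀ ≠ e₁) (h02 : e₀ ≠ e₂) (h12 : e₁ ≠ e₂)
    (hall : ∀ κ : Fin P.d, κ = e₀ ∨ κ = e₁ ∨ κ = e₂) (m : Site P j → Fin P.d → Fin P.d → ℤ) (hanti : ∀ x μ ν, m x ν μ = -m x μ ν)
    (hcube : ∀ x μ ν lam, (m x μ ν - m (x.shift lam) μ ν) + (m x ν lam - m (x.shift μ) ν lam) + (m x lam μ - m (x.shift ν) lam μ) = 0) :
    ∃ (q : Fin P.d → Fin P.d → ℤ) (s : PBond P j → ℤ), (∀ μ ν, q ν μ = -q μ ν) ∧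
      ∀ x μ ν, m x μ ν = q μ ν * (if x μ = -1 ∧ x ν = -1 then 1 else 0) + (s ⟨x, μ⟩ + s ⟨x.shift μ, ν⟩ - s ⟨x.shift ν, μ⟩ - s ⟨x, ν⟩) := by
  have h10 := Ne.symm h01; have h20 := Ne.symm h02; have h21 := Ne.symm h12
  have hdiag : ∀ x μ, m x μ μ = 0 := fun x μ => by have := hanti x μ μ; linarith
  have hc : ∀ x, (m x e₀ e₁ - m (x.shift e₂) e₀ e₁) - (m x e₀ e₂ - m (x.shift e₁) e₀ e₂) + (m x e₁ e₂ - m (x.shift e₀) e₁ e₂) = 0 := by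
    intro x
    have h := hcube x e₀ e₁ e₂
    rw [hanti x e₀ e₂, hanti (x.shift e₁) e₀ e₂] at h
    linarith
  obtain ⟨q₀₁, q₀₂, q₁₂, s₀, s₁, s₂, hdec⟩ := exists_int_class_decomposition_comp h01 h02 h12 hall (fun x => m x e₀ e₁) (fun x => m x e₀ e₂) (fun x => m x e₁ e₂) hc
  -- the class function and the bond cochain, by name
  obtain ⟨qf, hqf⟩ : ∃ qf : Fin P.d → Fin P.d → ℤ, qf = fun μ ν => if μ = e₀ ∧ ν = e₁ then q₀₁ else if μ = e₁ ∧ ν = e₀ then -q₀₁ else if μ = e₀ ∧ ν = e₂ then q₀₂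
      else if μ = e₂ ∧ ν = e₀ then -q₀₂ else if μ = e₁ ∧ ν = e₂ then q₁₂ else if μ = e₂ ∧ ν = e₁ then -q₁₂ else 0 := ⟨_, rfl⟩
  obtain ⟨sf, hsf⟩ : ∃ sf : PBond P j → ℤ, sf = fun b => if b.dir = e₀ then s₀ b.src else if b.dir = e₁ then s₁ b.src else s₂ b.src := ⟨_, rfl⟩
  have q01 : qf e₀ e₁ = q₀₁ := by rw [hqf]; dsimp only; rw [if_pos ⟨rfl, rfl⟩]
  have q10 : qf e₁ e₀ = -q₀₁ := by rw [hqf]; dsimp only; rw [if_neg (fun h => h10 h.1), if_pos ⟨rfl, rfl⟩]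
  have q02 : qf e₀ e₂ = q₀₂ := by rw [hqf]; dsimp only; rw [if_neg (fun h => h21 h.2), if_neg (fun h => h01 h.1), if_pos ⟨rfl, rfl⟩]
  have q20 : qf e₂ e₀ = -q₀₂ := by
    rw [hqf]; dsimp only; rw [if_neg (fun h => h20 h.1), if_neg (fun h => h21 h.1), if_neg (fun h => h20 h.1), if_pos ⟨rfl, rfl⟩]
  have q12 : qf e₁ e₂ = q₁₂ := by
    rw [hqf]; dsimp only; rw [if_neg (fun h => h10 h.1), if_neg (fun h => h20 h.2), if_neg (fun h => h10 h.1), if_neg (fun h => h12 h.1), if_pos ⟨rfl, rfl⟩]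
  have q21 : qf e₂ e₁ = -q₁₂ := by
    rw [hqf]; dsimp only
    rw [if_neg (fun h => h20 h.1), if_neg (fun h => h21 h.1), if_neg (fun h => h20 h.1), if_neg (fun h => h10 h.2), if_neg (fun h => h21 h.1), if_pos ⟨rfl, rfl⟩]
  have q00 : qf e₀ e₀ = 0 := by
    rw [hqf]; dsimp only
    rw [if_neg (fun h => h01 h.2), if_neg (fun h => h01 h.1), if_neg (fun h => h02 h.2), if_neg (fun h => h02 h.1), if_neg (fun h => h01 h.1), if_neg (fun h => h02 h.1)]
  have q11 : qf e₁ e₁ = 0 := by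
    rw [hqf]; dsimp only
    rw [if_neg (fun h => h10 h.1), if_neg (fun h => h10 h.2), if_neg (fun h => h10 h.1), if_neg (fun h => h12 h.1), if_neg (fun h => h12 h.2), if_neg (fun h => h12 h.1)]
  have q22 : qf e₂ e₂ = 0 := by
    rw [hqf]; dsimp only
    rw [if_neg (fun h => h20 h.1), if_neg (fun h => h21 h.1), if_neg (fun h => h20 h.1), if_neg (fun h => h20 h.2), if_neg (fun h => h21 h.1), if_neg (fun h => h21 h.2)]
  have hs0 : ∀ y, sf ⟨y, e₀⟩ = s₀ y := fun y => by rw [hsf]; dsimp only; rw [if_pos rfl]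
  have hs1 : ∀ y, sf ⟨y, e₁⟩ = s₁ y := fun y => by rw [hsf]; dsimp only; rw [if_neg h10, if_pos rfl]
  have hs2 : ∀ y, sf ⟨y, e₂⟩ = s₂ y := fun y => by rw [hsf]; dsimp only; rw [if_neg h20, if_neg h21]
  have Ecomm : ∀ (y : Site P j) (μ ν : Fin P.d), (if y ν = -1 ∧ y μ = -1 then (1:ℤ) else 0) = (if y μ = -1 ∧ y ν = -1 then 1 else 0) :=
    fun y μ ν => by simp only [and_comm]
  refine ⟨qf, sf, ?_, ?_⟩
  · intro μ ν
    rcases hall μ with hμ | hμ | hμ <;> rcases hall ν with hν | hν | hν <;> rw [hμ, hν] <;>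
      simp only [q01, q10, q02, q20, q12, q21, q00, q11, q22, neg_neg, neg_zero]
  · intro x μ ν
    obtain ⟨d1, d2, d3⟩ := hdec x
    rcases hall μ with hμ | hμ | hμ <;> rcases hall ν with hν | hν | hν <;> rw [hμ, hν]
    · rw [hdiag, q00, hs0, hs0]; ring
    · rw [q01, hs0, hs1, hs0, hs1]; linear_combination d1
    · rw [q02, hs0, hs2, hs0, hs2]; linear_combination d2
    · rw [q10, hs1, hs0, hs1, hs0, Ecomm x e₀ e₁]; linear_combination hanti x e₀ e₁ - d1
    · rw [hdiag, q11, hs1, hs1]; ring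
    · rw [q12, hs1, hs2, hs1, hs2]; linear_combination d3
    · rw [q20, hs2, hs0, hs2, hs0, Ecomm x e₀ e₂]; linear_combination hanti x e₀ e₂ - d2
    · rw [q21, hs2, hs1, hs2, hs1, Ecomm x e₁ e₂]; linear_combination hanti x e₁ e₂ - d3
    · rw [hdiag, q22, hs2, hs2]; ring

end Summit.QuantumFields.YangMills.Theorems.LinearLiftFlux

end
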